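import Mathlib
import Summits.BirchSwinnertonDyer.BirchSwinnertonDyer.Theorems.KatoDescentTamePotSupersingularTameLowerFibreAdjointBricksFiveNewformDatum

/-!
# Bricks for the `GL₂(𝔽₅)`-lifting route (T5′), XXII: `K = ℚ₅(ι K_g)` is finite over `ℚ₅` when the
# coefficient field `K_g` is a number field — the T1 `LatticeClause` shape modulo the tree's named fact
# «`K_g` finite over `ℚ`» and the displayed residual covering only

Continuation of file XXI (`…AdjointBricksFiveNewformDatum`, same namespace). File XXI displays
`[FiniteDimensional ℚ_[5] (padicCoeffField ι)]`. This file derives it from `FiniteDimensional ℚ (coeffField g)`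
— the shape of the tree's named facts `IsNewform0.finiteDimensional_coeffField` /
`IsNewform1.finiteDimensional_coeffField` (Shimura 1971 Thm. 3.48; `Literature/…/Newforms.lean`) — by
elementary field theory: `ℚ₅(ι K_g) ≤ ℚ₅(ι b₁, …, ι b_d)` for a `ℚ`-basis `(b_i)` of `K_g`, each `ι b_i` being
algebraic over `ℚ`, hence over `ℚ₅` (`finiteDimensional_padicCoeffField`). Consequently the T1-shaped
conclusion of XXI for an integral newform datum `Δ : OrdinaryNewformDatum g 5 ι` holds modulo EXACTLY:
`FiniteDimensional ℚ (coeffField g)` (named print) and the DISPLAYED residual covering of `Δ.ρ`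
(`exists_latticeClause_of_residual_covering_newformDatum_of_finiteDimensional_coeffField`). Route-free, no
definitions, nothing about elliptic curves or items 19618/19981 (open). Target T-S7r07-1 (Δ1@5).
-/

set_option linter.dupNamespace false

open Matrix IsLocalRing
open scoped MatrixGroups ModularForm

namespace Summit.BirchSwinnertonDyer.BirchSwinnertonDyer.Theorems.GL2F5AdjointBricks

section coeffField

open CongruenceSubgroup
open Literature.NumberTheory.GaloisRepresentations Literature.NumberTheory.EllipticCurves.ModularForms
  Literature.NumberTheory.EllipticCurves.GreenbergSelmer

variable {Γ : Subgroup (GL (Fin 2) ℝ)} {k : ℤ} {g : CuspForm Γ k} {p : ℕ} [Fact p.Prime]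

/-- **`K = ℚ_p(ι K_g)` is finite over `ℚ_p` when `K_g` is finite over `ℚ`**: the `p`-adic coefficient field of
an embedded cusp form with a number field of coefficients is a finite extension of `ℚ_p`. -/
theorem finiteDimensional_padicCoeffField (ι : coeffField g →+* PadicAlgCl p)
    [FiniteDimensional ℚ (coeffField g)] : FiniteDimensional ℚ_[p] (padicCoeffField ι) := by
  classical
  let b := Module.finBasis ℚ (coeffField g)
  let T : Set (PadicAlgCl p) := Set.range fun i => ι (b i)
  haveI : Finite T := (Set.finite_range _).to_subtype
  have hint : ∀ x ∈ T, IsIntegral ℚ_[p] x := by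
    rintro x ⟨i, rfl⟩
    have h1 : IsIntegral ℚ (b i) := Algebra.IsIntegral.isIntegral (b i)
    have h2 : IsIntegral ℚ (ι.toRatAlgHom (b i)) := h1.map ι.toRatAlgHom
    exact h2.tower_top
  haveI : FiniteDimensional ℚ_[p] (IntermediateField.adjoin ℚ_[p] T) :=
    IntermediateField.finiteDimensional_adjoin hint
  have hle : padicCoeffField ι ≤ IntermediateField.adjoin ℚ_[p] T := by
    change IntermediateField.adjoin ℚ_[p] (Set.range ι) ≤ _
    refine IntermediateField.adjoin_le_iff.2 ?_
    rintro _ ⟨x, rfl⟩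
    rw [← b.sum_repr x, map_sum]
    refine sum_mem fun i _ => ?_
    rw [Algebra.smul_def, map_mul, eq_ratCast, map_ratCast]
    exact mul_mem (SubfieldClass.ratCast_mem _ _) (IntermediateField.subset_adjoin _ _ ⟨i, rfl⟩)
  exact FiniteDimensional.of_injective (IntermediateField.inclusion hle).toLinearMap
    (IntermediateField.inclusion_injective hle)

universe u

/-- **Kato's (12.5.2) from the residual covering at `𝒪 = padicCoeffIntegers ι`, `K_g` a number field.** As
`exists_conj_SL2_le_image_absoluteGaloisGroup_padicCoeffIntegers` (XXI) with `FiniteDimensional ℚ (coeffField g)`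
in place of the finiteness of `ℚ₅(ι K_g)/ℚ₅`. -/
theorem exists_conj_SL2_le_image_absoluteGaloisGroup_padicCoeffIntegers_of_finiteDimensional_coeffField
    [Fact (Nat.Prime 5)] (ι : coeffField g →+* PadicAlgCl 5) [FiniteDimensional ℚ (coeffField g)]
    (K : Type u) [Field K] (ρ : Field.absoluteGaloisGroup K →* GL (Fin 2) (padicCoeffIntegers ι))
    (hρ : Continuous ρ)
    (hres : ∀ q : GL (Fin 2) (ZMod 5), ∃ γ : Field.absoluteGaloisGroup K, ∀ i j,
      ‖padicCoeffIntegers.toPadicAlgCl ι ((ρ γ).val i j - ((q.val i j).val : ℕ))‖ < 1) :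
    ∃ u : GL (Fin 2) (padicCoeffIntegers ι),
      (∀ i j, ‖padicCoeffIntegers.toPadicAlgCl ι
        (u.val i j - (1 : Matrix (Fin 2) (Fin 2) (padicCoeffIntegers ι)) i j)‖ < 1) ∧
      ∀ (φ : ℤ_[5] →+* padicCoeffIntegers ι) (s : SL(2, ℤ_[5])), ∃ σ : Field.absoluteGaloisGroup K,
        (∀ (k : ℕ) (t : AlgebraicClosure K), 0 < k → t ^ k = 1 → σ • t = t) ∧
          ρ σ = u * Matrix.GeneralLinearGroup.map φ (Matrix.SpecialLinearGroup.toGL s) * u⁻¹ := by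
  haveI := finiteDimensional_padicCoeffField ι
  exact exists_conj_SL2_le_image_absoluteGaloisGroup_padicCoeffIntegers ι K ρ hρ hres

/-- **T1 `LatticeClause Δ` for an integral ordinary newform datum, modulo exactly: `K_g` a number field
(`FiniteDimensional ℚ (coeffField g)`, the shape of the tree's named fact
`IsNewform0.finiteDimensional_coeffField`) and the DISPLAYED residual covering of `Δ.ρ`.** -/
theorem exists_latticeClause_of_residual_covering_newformDatum_of_finiteDimensional_coeffField
    [Fact (Nat.Prime 5)] {M : ℕ} {k' : ℤ} {g' : CuspForm (Gamma0 M) k'} (ι' : coeffField g' →+* PadicAlgCl 5)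
    [FiniteDimensional ℚ (coeffField g')] (Δ : OrdinaryNewformDatum g' 5 ι')
    (hres : ∀ q : GL (Fin 2) (ZMod 5), ∃ γ : Field.absoluteGaloisGroup ℚ, ∀ i j,
      ‖padicCoeffIntegers.toPadicAlgCl ι' ((Δ.ρ γ).val i j - ((q.val i j).val : ℕ))‖ < 1) :
    ∃ P : GL (Fin 2) (padicCoeffIntegers ι'), ∀ A : SL(2, ℤ_[5]), ∃ σ : Field.absoluteGaloisGroup ℚ,
      (∀ (k : ℕ) (t : AlgebraicClosure ℚ), 0 < k → t ^ k = 1 → σ • t = t) ∧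
        ((P * Δ.ρ σ * P⁻¹ : GL (Fin 2) (padicCoeffIntegers ι')) :
            Matrix (Fin 2) (Fin 2) (padicCoeffIntegers ι')).map (padicCoeffIntegers.toPadicAlgCl ι') =
          (A : Matrix (Fin 2) (Fin 2) ℤ_[5]).map ((algebraMap ℚ_[5] (PadicAlgCl 5)).comp PadicInt.Coe.ringHom) := by
  haveI := finiteDimensional_padicCoeffField ι'
  exact exists_latticeClause_of_residual_covering_newformDatum ι' Δ hres

end coeffField

/-! ### Residual covering after an `𝒪`-basis change (the form delivered by `ρ̄ ≅ ρ̄_W ⊗ k`, `Surj W 5`) -/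

section conjugatedCovering

open CongruenceSubgroup
open Literature.NumberTheory.GaloisRepresentations Literature.NumberTheory.EllipticCurves.ModularForms
  Literature.NumberTheory.EllipticCurves.GreenbergSelmer

universe u

variable (K : Type u) [Field K] [Fact (Nat.Prime 5)] (L : IntermediateField ℚ_[5] (PadicAlgCl 5))
  [FiniteDimensional ℚ_[5] L] (S : Subring L) (hS : ∀ x : L, x ∈ S ↔ ‖(x : PadicAlgCl 5)‖ ≤ 1)

include hS in
/-- **T1 `LatticeClause` shape from a residual covering AFTER A BASIS CHANGE** (unit-ball subring `S` of a
finite `L/ℚ₅`): if for some `P₀ ∈ GL₂(S)` the conjugate `P₀·ρ·P₀⁻¹` covers `GL₂(𝔽₅)` residually (norm form) —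
which is what an isomorphism `ρ̄ ≅ ρ̄_W ⊗ k` with `ρ̄_W(Γ) = GL₂(𝔽₅)` delivers — then some `P ∈ GL₂(S)` has, for
every `A ∈ SL₂(ℤ₅)`, a `σ` fixing every root of unity with `(P·ρ(σ)·P⁻¹` read in `ℚ̄₅) = A`. -/
theorem exists_latticeClause_of_conj_residual_covering_unitBallSubring
    (ρ : Field.absoluteGaloisGroup K →* GL (Fin 2) S) (hρ : Continuous ρ)
    (hres : ∃ P₀ : GL (Fin 2) S, ∀ q : GL (Fin 2) (ZMod 5), ∃ γ : Field.absoluteGaloisGroup K, ∀ i j,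
      ‖(((P₀ * ρ γ * P₀⁻¹).val i j - ((q.val i j).val : ℕ) : S) : L)‖ < 1) :
    ∃ P : GL (Fin 2) S, ∀ A : SL(2, ℤ_[5]), ∃ σ : Field.absoluteGaloisGroup K,
      (∀ (k : ℕ) (t : AlgebraicClosure K), 0 < k → t ^ k = 1 → σ • t = t) ∧
        ((P * ρ σ * P⁻¹ : GL (Fin 2) S) : Matrix (Fin 2) (Fin 2) S).map
            (fun x : S => ((x : L) : PadicAlgCl 5)) =
          (A : Matrix (Fin 2) (Fin 2) ℤ_[5]).map ((algebraMap ℚ_[5] (PadicAlgCl 5)).comp PadicInt.Coe.ringHom) := by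
  obtain ⟨P₀, hP₀⟩ := hres
  have hρ' : Continuous ((MulAut.conj P₀).toMonoidHom.comp ρ) := by
    show Continuous fun γ => P₀ * ρ γ * P₀⁻¹
    exact (continuous_const.mul hρ).mul continuous_const
  obtain ⟨P, hP⟩ := exists_latticeClause_of_residual_covering_unitBallSubring K L S hS
    ((MulAut.conj P₀).toMonoidHom.comp ρ) hρ' hP₀
  refine ⟨P * P₀, fun A => ?_⟩
  obtain ⟨σ, hσ, hσA⟩ := hP A
  refine ⟨σ, hσ, ?_⟩
  have e : P * P₀ * ρ σ * (P * P₀)⁻¹ = P * ((MulAut.conj P₀).toMonoidHom.comp ρ) σ * P⁻¹ := by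
    show P * P₀ * ρ σ * (P * P₀)⁻¹ = P * (P₀ * ρ σ * P₀⁻¹) * P⁻¹
    rw [_root_.mul_inv_rev, ← mul_assoc, mul_assoc P P₀ (ρ σ), mul_assoc P (P₀ * ρ σ) P₀⁻¹]
  rw [e]
  exact hσA

/-- **T1 `LatticeClause Δ` for an integral ordinary newform datum from a residual covering after a basis
change**, modulo exactly `K_g` a number field and that displayed covering (the honest remainder of the (C1)
reading: `ρ̄_Δ ≅ ρ̄_W ⊗ k` from the congruence of Hecke eigenvalues, with `Surj W 5`). -/
theorem exists_latticeClause_of_conj_residual_covering_newformDatum {M : ℕ} {k' : ℤ}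
    {g' : CuspForm (Gamma0 M) k'} (ι' : coeffField g' →+* PadicAlgCl 5) [FiniteDimensional ℚ (coeffField g')]
    (Δ : OrdinaryNewformDatum g' 5 ι')
    (hres : ∃ P₀ : GL (Fin 2) (padicCoeffIntegers ι'), ∀ q : GL (Fin 2) (ZMod 5),
      ∃ γ : Field.absoluteGaloisGroup ℚ, ∀ i j,
        ‖padicCoeffIntegers.toPadicAlgCl ι' ((P₀ * Δ.ρ γ * P₀⁻¹).val i j - ((q.val i j).val : ℕ))‖ < 1) :
    ∃ P : GL (Fin 2) (padicCoeffIntegers ι'), ∀ A : SL(2, ℤ_[5]), ∃ σ : Field.absoluteGaloisGroup ℚ,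
      (∀ (k : ℕ) (t : AlgebraicClosure ℚ), 0 < k → t ^ k = 1 → σ • t = t) ∧
        ((P * Δ.ρ σ * P⁻¹ : GL (Fin 2) (padicCoeffIntegers ι')) :
            Matrix (Fin 2) (Fin 2) (padicCoeffIntegers ι')).map (padicCoeffIntegers.toPadicAlgCl ι') =
          (A : Matrix (Fin 2) (Fin 2) ℤ_[5]).map ((algebraMap ℚ_[5] (PadicAlgCl 5)).comp PadicInt.Coe.ringHom) := by
  haveI := finiteDimensional_padicCoeffField ι'
  exact exists_latticeClause_of_conj_residual_covering_unitBallSubring ℚ (padicCoeffField ι')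
    (padicCoeffIntegers ι') (mem_padicCoeffIntegers_iff ι') Δ.ρ.toMonoidHom (map_continuous Δ.ρ) hres

end conjugatedCovering

end Summit.BirchSwinnertonDyer.BirchSwinnertonDyer.Theorems.GL2F5AdjointBricks
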